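import Literature.NumberTheory.EllipticCurves.Rank1Residual.ClassX1KellerYinMainConjecture
import Literature.NumberTheory.EllipticCurves.CastellaGrossiLeeSkinner2022.RankOneTwistIdentity
import HarnessLib

/-!
# Class X1, analytic rank ZERO, type A: `BSD(E,p)` from the anticyclotomic display read in the
# swapped orientation and `BSD(E^K,p)` for the rank-ONE type-B twist (cell `bsd-eis`, seat `bsd-eis-ky`)

HONEST FRAMING (cell `bsd-eis`, home `run/shared/lean/pub/bsd-eis/`; FULL-BSD rank-≤1 programme,
row A3 = X1b ∩ {r = 0}: good anomalous Eisenstein prime `p > 2`, parity type A, `L(E,1) ≠ 0`).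
Nothing here is unconditional and nothing is booked: every theorem takes the anticyclotomic display
as an explicit HYPOTHESIS (`hdisp`, the per-pair instance of the identity
`def_p(E) + def_p(E^K) = 0` in the orientation `ord_{s=1} L(E,s) = 0`, `ord_{s=1} L(E^K,s) = 1`),
whose only non-published input is Keller–Yin's λ/μ comparison at an anomalous prime
(arXiv:2402.12781v2 Thms. 1.5.1 + 2.2.2/2.2.3; audited line by line in the seat memo
`run/shared/lean/pub/bsd-eis/bsd-eis-ky-MEMO-1.md`, §§2–3, Theorem B of §5.2). The point of the
file is the BOOKKEEPING observation of that memo: the anticyclotomic package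
(IMC + control + BDP + Gross–Zagier + Kolyvagin over `K`) is blind to WHICH of `E`, `E^K` carries
the rank, so at a rank-`0` type-A pair the display transfers `BSD(E,p)` from the rank-`1` TYPE-B
twist `E^K` — where Mazur's main conjecture IS Greenberg–Vatsal's theorem and `BSD(E^K,p)` follows
modulo the Schneider certificate (row C1) by the tree's
`X1.mainConjecture_iff_bsdp_of_analyticRank_eq_one` — with NO appeal to the (unproved) cyclotomic
main conjecture at a type-A anomalous prime (`Rank1ResidualX1Defs.MazurMainConjectureOnX1TypeA`).

* `bsdp_rankZero_of_displaySwap_of_bsdp_twist` — display (swapped) + `BSDp Wd p` for ANY globally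
  minimal elliptic `Wd` with `ord_{s=1} L ≤ 1` ⟹ `BSDp W p` (pure bookkeeping: `pPart_of_bsdp`,
  `bsdp_of_pPartRankZero`).
* `classX1_gvPar_twist_of_not_gvPar` — the admissible twist of a type-A X1 pair with `L'(E^K,1)`
  of order one is an X1 pair of TYPE B (good, reducible, anomalous: `a_p(E^K) = a_p(E)`; parity
  swapped by the odd unramified-at-`p` twist).
* `bsdp_rankZero_typeA_of_displaySwap_of_schneider_twist` — X1 ∩ {r = 0, type A} ⟹ `BSDp W p`
  from the swapped display, Greenberg–Vatsal 2000 Thm. 1.3 on the twist, and the Schneider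
  certificate on the twist (PUBLISHED named facts: Wuthrich 2014 Thm. 16, Perrin-Riou–Schneider
  (BMS), Perrin-Riou 1987, Mazur–Tate sigma, modularity, GZK).

References: Keller–Yin arXiv:2402.12781v2 Thm. 4.2.1 and p. 22; Castella–Grossi–Lee–Skinner,
Invent. Math. 227 (2022) (5.5)–(5.7); Greenberg–Vatsal, Invent. Math. 142 (2000) Thm. 1.3;
Wuthrich, Doc. Math. 19 (2014) Thm. 16; Miller, LMS JCM 14 (2011) Def. 1.1.
-/

set_option linter.dupNamespace false
set_option autoImplicit false

noncomputable section

open scoped Classical MatrixGroups ModularForm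

open CongruenceSubgroup WeierstrassCurve Literature.NumberTheory.EllipticCurves
  Literature.NumberTheory.EllipticCurves.ModularForms Literature.NumberTheory.EllipticCurves.Rank1Residual
  Literature.NumberTheory.EllipticCurves.Wuthrich2014

namespace Summit.BirchSwinnertonDyer.BirchSwinnertonDyer.Theorems.Rank1ResidualX1RankZeroTwist

/-- **Swapped display + `BSD(E^K,p)` ⟹ `BSD(E,p)` in analytic rank `0`** (bookkeeping). For `W/ℚ`
globally minimal elliptic with `ord_{s=1} L(E,s) = 0` and `L(E,1)/Ω_E ∈ ℚ` (`hMD`, Manin–Drinfeld,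
taken as a per-pair hypothesis), ANY globally minimal elliptic `Wd` with `ord_{s=1} L(Wd,s) ≤ 1`
and `BSDp Wd p`, and the display in the swapped orientation (`hdisp`:
`ord_p(L(E,1)/(Ω_E)) − ord_p #Ш(E) − ord_p ∏c_ℓ(E) + 2 ord_p #E(ℚ)_tors
 = −(ord_p(L^{(r)}(Wd,1)/(r! Ω Reg)) − ord_p #Ш(Wd) − ord_p ∏c_ℓ(Wd) + 2 ord_p #Wd(ℚ)_tors)`):
Miller's `BSDp W p`. Inputs: modularity (`hmod`), Gross–Zagier–Kolyvagin (`hGZK`).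
[cite: KellerYin2024, proof of Thm. 4.2.1 (p. 22), the display, read with the roles of E and E^K exchanged]
[cite: Miller2011LMS, Def. 1.1 (arXiv:1010.2431 p. 3)] -/
theorem bsdp_rankZero_of_displaySwap_of_bsdp_twist (hmod : hasEntireLFunction_rat)
    (hGZK : rank_eq_analyticRank_of_analyticRank_le_one)
    (W : WeierstrassCurve ℚ) [W.IsElliptic] [W.IsGloballyMinimal] (p : ℕ) [Fact p.Prime]
    (hr : W.analyticRank = 0)
    (hMD : ∃ q : ℚ, W.entireLFunction 1 / (W.realPeriodRat : ℂ) = (q : ℂ))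
    (Wd : WeierstrassCurve ℚ) [Wd.IsElliptic] [Wd.IsGloballyMinimal] (hrd : Wd.analyticRank ≤ 1)
    (hBd : BSDp Wd p)
    (hdisp : ∀ (q qd : ℚ), W.entireLFunction 1 / (W.realPeriodRat : ℂ) = (q : ℂ) →
        Wd.leadingLCoeff / ((Wd.realPeriodRat * Wd.regulator : ℝ) : ℂ) = (qd : ℂ) →
        padicValRat p q - ((padicValNat p W.shaOrder : ℤ) + padicValNat p W.tamagawaProduct -
            2 * padicValNat p W.torsionOrder) =
          -(padicValRat p qd - ((padicValNat p Wd.shaOrder : ℤ) + padicValNat p Wd.tamagawaProduct -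
            2 * padicValNat p Wd.torsionOrder))) :
    BSDp W p := by
  obtain ⟨q, hq⟩ := hMD
  obtain ⟨qd, hqd, hvd⟩ := pPart_of_bsdp hmod hGZK Wd p hrd hBd
  have h := hdisp q qd hq hqd
  have hv : padicValRat p q = (padicValNat p W.shaOrder : ℤ) + padicValNat p W.tamagawaProduct -
      2 * padicValNat p W.torsionOrder := by
    rw [hvd] at h
    linarith
  exact bsdp_of_pPartRankZero W p hmod hGZK hr ⟨q, hq, hv⟩

/-- **The admissible twist of a type-A X1 pair, of analytic rank one, is an X1 pair of type B.**
For `W/ℚ` globally minimal elliptic with `ClassX1 W p` and `¬ GVPar W p`, `K` imaginary quadratic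
with odd discriminant in which `p` splits, and `Wd` a globally minimal model of `E^{(d_K)}` with
`ord_{s=1} L(E^{(d_K)},s) = 1`: `ClassX1 Wd p ∧ GVPar Wd p` — good and ordinary at `p`
(`isOrdinaryAt_of_smul_eq_quadraticTwist`, `p ∤ 2 d_K`), reducible
(`not_hasIrreducibleModPGaloisRep_twist`), anomalous since `a_p(E^K) = a_p(E)` for `p` split
(`frobeniusTrace_eq_of_split_twist`, Knapp Prop. 12.10), and of parity type B
(`gvPar_of_not_gvPar_of_twist`: the odd twist unramified at `p` swaps the types). [folklore] -/
theorem classX1_gvPar_twist_of_not_gvPar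
    (W : WeierstrassCurve ℚ) [W.IsElliptic] [W.IsGloballyMinimal] (p : ℕ) [Fact p.Prime]
    (hX1 : ClassX1 W p) (hA : ¬ GVPar W p)
    (K : Type) [Field K] [NumberField K] (hK : IsImaginaryQuadratic K)
    (hodd : Odd (NumberField.discr K)) (hsplit : SatisfiesHeegnerHypothesis p K)
    (Wd : WeierstrassCurve ℚ) [Wd.IsElliptic] [Wd.IsGloballyMinimal]
    (hWd : ∃ C : VariableChange ℚ, C • Wd = W.quadraticTwist (NumberField.discr K : ℚ))
    (hrd : Wd.analyticRank = 1) :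
    ClassX1 Wd p ∧ GVPar Wd p := by
  have hp : p.Prime := Fact.out
  have hp2 : p ≠ 2 := by have := hX1.1; omega
  have hgood : W.HasGoodReductionAtPrime p := hX1.2.2.1
  have hred : ¬ W.HasIrreducibleModPGaloisRep p := hX1.2.1
  have hanom : (p : ℤ) ∣ W.frobeniusTrace p - 1 := hX1.2.2.2.1.2.2
  have hord : ¬ (p : ℤ) ∣ W.frobeniusTrace p :=
    KellerYin2024.not_dvd_frobeniusTrace_of_anomalous W p hanom
  obtain ⟨C, hC⟩ := hWd
  have hdneg : NumberField.discr K < 0 := IsImaginaryQuadratic.discr_neg hK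
  have hsqf : Squarefree (NumberField.discr K) := squarefree_discr_of_odd hK hodd
  have hpd : ¬ (p : ℤ) ∣ NumberField.discr K := not_dvd_discr_of_split hK hp hp2 hsplit
  have hd0 : (NumberField.discr K : ℚ) ≠ 0 := by exact_mod_cast hdneg.ne
  -- good ordinary at `p`, reducible, type B
  obtain ⟨hgood_d, -⟩ :=
    isOrdinaryAt_of_smul_eq_quadraticTwist W Wd hsqf hC p hp2 hpd ⟨hgood, hord⟩
  have hred_d : ¬ Wd.HasIrreducibleModPGaloisRep p :=
    not_hasIrreducibleModPGaloisRep_twist hred hd0 Wd C hC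
  have hpar_d : GVPar Wd p := gvPar_of_not_gvPar_of_twist hp2 hred hA hdneg hpd Wd C hC
  -- anomalous: `a_p(E^K) = a_p(E)`
  have ha : Wd.frobeniusTrace p = W.frobeniusTrace p :=
    CastellaGrossiLeeSkinner2022.frobeniusTrace_eq_of_split_twist hX1.1 hgood K hK hodd hsplit Wd
      ⟨C, hC⟩
  have hanom_d : (p : ℤ) ∣ Wd.frobeniusTrace p - 1 := by rw [ha]; exact hanom
  refine ⟨⟨hX1.1, hred_d, hgood_d, ⟨hred_d, hgood_d, hanom_d⟩, fun h ↦ ?_⟩, hpar_d⟩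
  omega

/-- **X1 ∩ {r = 0, type A} ⟹ `BSD(E,p)` WITHOUT a cyclotomic main conjecture at the type-A prime**
(Theorem B of the seat memo, route (B-i)). Let `W/ℚ` be globally minimal elliptic, `ClassX1 W p`,
`¬ GVPar W p` (type A), `ord_{s=1} L(E,s) = 0`, `L(E,1)/Ω_E ∈ ℚ` (`hMD`); `K` imaginary quadratic
with odd discriminant and `p` split; `Wd` a globally minimal model of `E^{(d_K)}` with
`ord_{s=1} L(E^{(d_K)},s) = 1` carrying the Schneider certificate `hSchd` (non-degeneracy of the
canonical cyclotomic `p`-adic height on `E^{(d_K)}` — row C1); and `hdisp` the anticyclotomic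
display for `(E, E^K)` in the swapped orientation (HYPOTHESIS; = Keller–Yin's IMC + control over `K`,
seat memo §5.2). PUBLISHED named facts: Greenberg–Vatsal 2000 Thm. 1.3 (`hGV`, Mazur's main
conjecture for the TYPE-B curve `E^K`), Wuthrich 2014 Thm. 16 (`hW16`), Perrin-Riou–Schneider at odd
`p` (`hS`), Perrin-Riou 1987 (`hPR`), Mazur–Tate sigma (`hMT`), modularity (`hmodP`, `hmod`),
Gross–Zagier–Kolyvagin (`hGZK`). Proof: `E^K` is an X1 pair of type B and rank one
(`classX1_gvPar_twist_of_not_gvPar`), so Mazur's main conjecture holds for it (`hGV`) and is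
equivalent there to `BSDp Wd p` given the certificate (`X1.mainConjecture_iff_bsdp_of_analyticRank_eq_one`);
then `bsdp_rankZero_of_displaySwap_of_bsdp_twist`.
[cite: GreenbergVatsal2000, Thm. (1.3)] [cite: Wuthrich2014, Thm. 16 (p. 393) and §6 (p. 400)]
[cite: KellerYin2024, proof of Thm. 4.2.1 (p. 22) (display, roles of E and E^K exchanged; hypothesis)] -/
theorem bsdp_rankZero_typeA_of_displaySwap_of_schneider_twist
    (hGV : GreenbergVatsal2000.thm13_charIdeal_eq_of_gvPar)
    (hW16 : charIdeal_dvd_padicLFunction) (hS : Schneider1985_order_charGenerator_odd)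
    (hPR : perrinRiou_rankOne_leadingTerms_odd) (hMT : mazur_tate_sigma_exists_odd)
    (hmodP : nonempty_modularParametrizationData) (hmod : hasEntireLFunction_rat)
    (hGZK : rank_eq_analyticRank_of_analyticRank_le_one)
    (W : WeierstrassCurve ℚ) [W.IsElliptic] [W.IsGloballyMinimal] (p : ℕ) [Fact p.Prime]
    (hX1 : ClassX1 W p) (hA : ¬ GVPar W p) (hr : W.analyticRank = 0)
    (hMD : ∃ q : ℚ, W.entireLFunction 1 / (W.realPeriodRat : ℂ) = (q : ℂ))
    (K : Type) [Field K] [NumberField K] (hK : IsImaginaryQuadratic K)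
    (hodd : Odd (NumberField.discr K)) (hsplit : SatisfiesHeegnerHypothesis p K)
    (Wd : WeierstrassCurve ℚ) [Wd.IsElliptic] [Wd.IsGloballyMinimal]
    (hWd : ∃ C : VariableChange ℚ, C • Wd = W.quadraticTwist (NumberField.discr K : ℚ))
    (hrd : Wd.analyticRank = 1)
    (hSchd : ∀ Dh : PAdicHeightData Wd p, Dh.IsCanonical → SchneiderConjecture Dh)
    (hdisp : ∀ (q qd : ℚ), W.entireLFunction 1 / (W.realPeriodRat : ℂ) = (q : ℂ) →
        Wd.leadingLCoeff / ((Wd.realPeriodRat * Wd.regulator : ℝ) : ℂ) = (qd : ℂ) →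
        padicValRat p q - ((padicValNat p W.shaOrder : ℤ) + padicValNat p W.tamagawaProduct -
            2 * padicValNat p W.torsionOrder) =
          -(padicValRat p qd - ((padicValNat p Wd.shaOrder : ℤ) + padicValNat p Wd.tamagawaProduct -
            2 * padicValNat p Wd.torsionOrder))) :
    BSDp W p := by
  obtain ⟨hX1d, hpar_d⟩ := classX1_gvPar_twist_of_not_gvPar W p hX1 hA K hK hodd hsplit Wd hWd hrd
  have hXd := isClassX1_of_classX1 hX1d
  -- Greenberg–Vatsal: Mazur's main conjecture for the type-B twist
  have hMC := hGV Wd p hX1d.1.ne' hXd.hasGoodReductionAtPrime hXd.not_dvd_frobeniusTrace hpar_d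
  -- ... which, at a rank-one X1 pair with the certificate, is `BSDp Wd p`
  have hBd : BSDp Wd p :=
    (X1.mainConjecture_iff_bsdp_of_analyticRank_eq_one hW16 hS hPR hMT hmodP hGZK Wd p hX1d hrd
      hSchd).mp hMC
  exact bsdp_rankZero_of_displaySwap_of_bsdp_twist hmod hGZK W p hr hMD Wd (by omega) hBd hdisp

end Summit.BirchSwinnertonDyer.BirchSwinnertonDyer.Theorems.Rank1ResidualX1RankZeroTwist

end
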